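import Mathlib

/-!
# The fibre trace identity is exact (solo-blind, steady door §24.49(0))

For the oblique fibre system of §24.39(1) on a leaf of a STEADY carrier flow,
`u̇ = -(a_ττ + K₀Q) u + (c - a_τn - μ) b`, `ḃ = -(a_ττ + K₀Q) b + (2/Q)(a_ττ b - c u)`,
`Q = 1 + χ² v²`, the trace of the coefficient matrix is
`tr M = -2K₀Q - 2χ²v²a_ττ/Q` (pointwise algebra, `fibre_trace_pointwise`).  Along a streamline
of a steady flow `d(v²)/dt = 2 a_ττ v²`, so `χ²v²a_ττ/Q = ½ d/dt log(1 + χ²v²)` is an exact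
derivative of a `T`-periodic function and its period integral vanishes
(`fibre_trace_term_integral_eq_zero`, from the general periodic chain-rule lemma
`periodic_chain_integral_eq_zero`: `∫₀ᵀ g(v(t)) v'(t) dt = 0` whenever `v(T) = v(0)`).
Hence, by Liouville, `σ₁ + σ₂ = ⟨tr M⟩_t = -2K₀⟨Q⟩_t = -2K₀(1 + χ²⟨v²⟩_t)` EXACTLY at every
`(μ, χ)` (`fibre_trace_identity`: `∫₀ᵀ tr M = -2K₀ ∫₀ᵀ Q`).  Consequences recorded in the paper:
the EP/elliptic value `σ_EP(χ) = -K₀(1 + χ²⟨v²⟩_t)` (the s51 fit `-0.1768 - 0.2905χ²` is this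
identity with `⟨v²⟩_t = 1.643`), and `σ₂ ≤ -K₀` everywhere, so no level set of the spectral
window `|s| ≤ c₀ < K₀` contains a second-sheet arc.
-/

namespace Summit.AnomalousDissipation.AnomalousDissipation.Theorems

open Real intervalIntegral

/-- Periodic chain rule: if `v` is `C¹` with `v T = v 0` and `g` is continuous, then
`∫₀ᵀ g(v t) · v'(t) dt = 0` (the integrand is the derivative of `G ∘ v`, `G` a primitive of `g`). -/
theorem periodic_chain_integral_eq_zero {g v v' : ℝ → ℝ} {T : ℝ} (hg : Continuous g)
    (hv : ∀ t, HasDerivAt v (v' t) t) (hv' : Continuous v') (hT : v T = v 0) :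
    ∫ t in (0:ℝ)..T, g (v t) * v' t = 0 := by
  set G : ℝ → ℝ := fun u => ∫ x in (0:ℝ)..u, g x with hG
  have hGd : ∀ u, HasDerivAt G (g u) u := fun u => (hg.integral_hasStrictDerivAt 0 u).hasDerivAt
  have hcomp : ∀ t, HasDerivAt (fun t => G (v t)) (g (v t) * v' t) t :=
    fun t => (hGd (v t)).comp t (hv t)
  have hvc : Continuous v := continuous_iff_continuousAt.2 fun t => (hv t).continuousAt
  have hint : IntervalIntegrable (fun t => g (v t) * v' t) MeasureTheory.volume 0 T :=
    ((hg.comp hvc).mul hv').intervalIntegrable 0 T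
  rw [integral_eq_sub_of_hasDerivAt (fun t _ => hcomp t) hint, hT, sub_self]

/-- Pointwise trace of the fibre matrix: with `Q = 1 + χ²w` (`w = v²`),
`M₁₁ + M₂₂ = -2K₀Q - 2·(a_ττ χ² w / Q)`. -/
theorem fibre_trace_pointwise (aτ K χ w : ℝ) (hQ : 1 + χ ^ 2 * w ≠ 0) :
    (-(aτ + K * (1 + χ ^ 2 * w))) + (-(aτ + K * (1 + χ ^ 2 * w)) + 2 * aτ / (1 + χ ^ 2 * w))
      = -(2 * K) * (1 + χ ^ 2 * w) - 2 * (aτ * (χ ^ 2 * w) / (1 + χ ^ 2 * w)) := by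
  field_simp
  ring

/-- The `μ`-independent, `a_ττ`-dependent part of the trace integrates to zero over a period:
if `w ≥ 0` is `C¹` with `w' = 2 a w` (steady streamline: `d(v²)/dt = 2a_ττ v²`) and `w T = w 0`,
then `∫₀ᵀ a χ² w/(1 + χ² w) dt = 0`. -/
theorem fibre_trace_term_integral_eq_zero {w a : ℝ → ℝ} {T : ℝ} (χ : ℝ) (ha : Continuous a)
    (hw : ∀ t, HasDerivAt w (2 * a t * w t) t) (hw0 : ∀ t, 0 ≤ w t) (hT : w T = w 0) :
    ∫ t in (0:ℝ)..T, a t * (χ ^ 2 * w t) / (1 + χ ^ 2 * w t) = 0 := by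
  have hwc : Continuous w := continuous_iff_continuousAt.2 fun t => (hw t).continuousAt
  -- primitive density g(x) = χ²/(2(1 + χ²|x|)), continuous on all of ℝ and equal to the
  -- wanted one on the range of w (w ≥ 0)
  have hden : ∀ x : ℝ, 2 * (1 + χ ^ 2 * |x|) ≠ 0 := fun x => by positivity
  have hg : Continuous fun x : ℝ => χ ^ 2 / (2 * (1 + χ ^ 2 * |x|)) :=
    continuous_const.div (continuous_const.mul (continuous_const.add
      (continuous_const.mul continuous_abs))) hden
  have hv'c : Continuous fun t => 2 * a t * w t := (continuous_const.mul ha).mul hwc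
  have key := periodic_chain_integral_eq_zero (g := fun x : ℝ => χ ^ 2 / (2 * (1 + χ ^ 2 * |x|)))
    (v := w) (v' := fun t => 2 * a t * w t) (T := T) hg hw hv'c hT
  rw [← key]
  congr 1
  ext t
  have h0 : 0 ≤ w t := hw0 t
  have h1 : (1 + χ ^ 2 * w t) ≠ 0 := by positivity
  simp only [abs_of_nonneg h0]
  field_simp

/-- THE TRACE IDENTITY: `∫₀ᵀ tr M dt = -2K₀ ∫₀ᵀ Q dt`, i.e. `σ₁ + σ₂ = -2K₀⟨Q⟩_t` exactly,
independent of the shear `μ` (which never enters the trace) and of `a_ττ`. -/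
theorem fibre_trace_identity {w a : ℝ → ℝ} {T : ℝ} (K₀ χ : ℝ) (ha : Continuous a)
    (hw : ∀ t, HasDerivAt w (2 * a t * w t) t) (hw0 : ∀ t, 0 ≤ w t) (hT : w T = w 0) :
    ∫ t in (0:ℝ)..T, (-(2 * K₀) * (1 + χ ^ 2 * w t) - 2 * (a t * (χ ^ 2 * w t) / (1 + χ ^ 2 * w t)))
      = -(2 * K₀) * ∫ t in (0:ℝ)..T, (1 + χ ^ 2 * w t) := by
  have hwc : Continuous w := continuous_iff_continuousAt.2 fun t => (hw t).continuousAt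
  have hden : ∀ t, (1 + χ ^ 2 * w t) ≠ 0 := fun t => by have := hw0 t; positivity
  have h1 : IntervalIntegrable (fun t => -(2 * K₀) * (1 + χ ^ 2 * w t)) MeasureTheory.volume 0 T :=
    (continuous_const.mul (continuous_const.add (continuous_const.mul hwc))).intervalIntegrable 0 T
  have h2c : Continuous fun t => 2 * (a t * (χ ^ 2 * w t) / (1 + χ ^ 2 * w t)) :=
    continuous_const.mul ((ha.mul (continuous_const.mul hwc)).div
      (continuous_const.add (continuous_const.mul hwc)) hden)
  have h2 : IntervalIntegrable (fun t => 2 * (a t * (χ ^ 2 * w t) / (1 + χ ^ 2 * w t)))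
      MeasureTheory.volume 0 T := h2c.intervalIntegrable 0 T
  rw [integral_sub h1 h2, integral_const_mul, integral_const_mul,
    fibre_trace_term_integral_eq_zero χ ha hw hw0 hT, mul_zero, sub_zero]

/-- Corollary used in the paper: the mean second exponent is at most `-K₀` times the mean of `Q ≥ 1`;
in integral form, if `∫₀ᵀ (σ₁ + σ₂)` equals `∫₀ᵀ tr M` and `σ₂ ≤ σ₁` pointwise-in-mean, then
`2 ∫ σ₂ ≤ -2K₀ ∫ Q`.  We record only the elementary real inequality behind it. -/
theorem half_trace_bound (σ₁ σ₂ K Qbar : ℝ) (hle : σ₂ ≤ σ₁) (htr : σ₁ + σ₂ = -(2 * K) * Qbar) :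
    σ₂ ≤ -K * Qbar := by
  nlinarith

end Summit.AnomalousDissipation.AnomalousDissipation.Theorems
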